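import Summits.AtomisticToContinuum.Crystallization.Theorems.FrustratedLawDichotomyStrainedPatchStiffSector

/-!
# ConeWitness kit — SHUFFLE-94-CERT lemmas L1 / L2 / L3 typed against the tree predicates (`ChartByGB`, `GoodAtScale`); L3 and the assembly PROVED
# (27623 `AperiodicFrustratedLawGap`, T-far lane, soft-sector kill target `…StiffSector.ConeWitness`; lens-5 g95, answer to census-1 g45 STATUS l.7978/7992)

decomp-a2c lens-5 g95.  The census (CERT94.md rev 2, sha256 086b35f4…) certified every clause of `ConeWitness … z c` for W94c outright or MODULO three
elementary lemmas; this file states the three against the tree's own predicates, proves what is pure algebra, and isolates what is finite geometry.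

* §1 **L3 PROVED** — `polyBends_secondDiff`: for `b ∈ polyBends q₂ q₃`, `‖b(w+p) − 2b(w) + b(w−p)‖ ≤ 2q₂‖p‖² + 6q₃‖w‖‖p‖²` (exact identity
  `= 2Qpp + 2(Cppw + Cpwp + Cwpp)`); record instance `bends0_secondDiff` (`‖p‖²/100 + 3‖w‖‖p‖²/1000`); ★ `chartByGB_secondDiff_le`: under
  `ChartByGB 𝓘 τ T B z c z₀ c₀ e` with a host of bent shape `z₀ a − z₀ c₀ = b (v a)` and a labelled collinear equally-spaced reference triple
  `v(e a₀), v(e a₁), v(e a₂) = w−p, w, w+p`, the cluster's second difference is `≤ B₁₀ + B₂₁ + 2q₂‖p‖² + 6q₃‖w‖‖p‖²` (contrapositive = the pair-clause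
  kill); `secondDiff_comp_isometry` (invariance under the `R` of `ConeWitness`).
* §2 **L1 / L2 TYPED, assembly PROVED** — `FitClauses` (one branch of `GoodAtScale`, verbatim) with `goodAtScale_iff_fitClauses` (definitional) and
  `not_goodAtScale_of_floors`; `ShellFrame y i d θ g s` (the per-site data the census certifies: forced assignment `s`, frame `g`, direction tolerance `θ`,
  shell inside and complete below `13/10·d`); ★ `ForcedAssignmentFcc η₀ θ` (L1) and ★ `HcpExcludedNearFcc η₀ θ` (L2) as `Prop`s with their intended finite
  proofs in the docstrings; ★★ `not_goodAtScale_of_shellFrame : L1 → L2 → ShellFrame → (Kabsch/minimax floor hK) → ¬GoodAtScale η₀ D y i` PROVED; the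
  finite pattern cores by `decide` on the Literature integer models: `fccInt_sub_sqNorm` (Gram gaps), `fccInt_neg_mem` (6 antipodal pairs),
  `hcpInt_antipodes` (= 6 vectors, 3 pairs), `hcpInt_add_sqNorm` (`‖u+u'‖² ≥ 1/3` unless antipodal).

NOTE «L1-MINIMAX» (checked against CERT94.md row 9): `hK` is a floor on `min over ALL linear isometries A'` (both chiralities, scale pinned at
`d = nearestDist`, no translation) of the MAX residual of the forced assignment; the census's `η ≥ max-residual ≥ RMS_min = 0.05231 > 1/20` IS such a
certificate (max ≥ RMS ≥ Kabsch minimum; a Kabsch fit WITH translation only weakens it), margin 4.6 % — so the typed `hK` below matches the certified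
quantity provided RMS is taken over the twelve forced bonds at the pinned scale.  For L3 the census triple is centred at the chart centre (`w = 0`), where
`bends0_secondDiff` gives the sharper allowance `‖p‖²/100` (cubic term vanishes) inside their `2(q₂ℓ² + 6q₃ℓ³)`.

L1, L2 are honest STATEMENTS (untagged `def … : Prop`, flagged `vendored-fact` by the file audit exactly like the landed `…StiffSector.ConeWitness`); the
recommended ledger form is two `support` items on the route (signatures = these defs at `η₀ = 1/20`, `θ = θ₀` of record) so provers can claim them.
0 sorry; standard axioms; no instances / notation.  `--supports stmt-AtomisticToContinuum-27623`.
-/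

namespace Summit.AtomisticToContinuum.Crystallization.Theorems.FrustratedLawDichotomyStrainedPatchConeWitnessKit

open scoped BigOperators RealInnerProductSpace
open Summit.AtomisticToContinuum.Crystallization.Theorems.ChargedEnergyGapNegative (E3)
open Summit.AtomisticToContinuum.Crystallization.Theorems.FrustratedLawDichotomyStrainedPatchChartFamiliesPinned (polyBends bends0)
open Summit.AtomisticToContinuum.Crystallization.Theorems.FrustratedLawDichotomyStrainedPatchQuantSlaving (ChartFam SlackTab)
open Summit.AtomisticToContinuum.Crystallization.Theorems.FrustratedLawDichotomyStrainedPatchPairTube (ChartByGB PairTab)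

/-! ## §1. L3 — the second-difference lemma for polynomial bendings (PROVED) -/

/-- ★ **L3 (second difference of a bending on a collinear equally-spaced triple).** For `b ∈ polyBends q₂ q₃` (`b v = v + Q v v + C v v v`):
`b (w + p) − 2 b w + b (w − p) = 2 Q p p + 2 (C p p w + C p w p + C w p p)` — the linear part cancels exactly and the cubic's `w³`, `w²p` terms cancel —
hence `‖b (w + p) − 2 b w + b (w − p)‖ ≤ 2 q₂ ‖p‖² + 6 q₃ ‖w‖ ‖p‖²`. [elementary multilinear algebra] -/
theorem polyBends_secondDiff {q₂ q₃ : ℝ} {b : E3 → E3} (hb : b ∈ polyBends q₂ q₃) (w p : E3) :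
    ‖b (w + p) - (2 : ℝ) • b w + b (w - p)‖ ≤ 2 * q₂ * ‖p‖ ^ 2 + 6 * q₃ * ‖w‖ * ‖p‖ ^ 2 := by
  obtain ⟨Q, C, hQ, hC, hbv⟩ := hb
  have key : b (w + p) - (2 : ℝ) • b w + b (w - p) = (2 : ℝ) • Q p p + (2 : ℝ) • (C p p w + C p w p + C w p p) := by
    rw [hbv (w + p), hbv w, hbv (w - p)]
    simp only [map_add, map_sub, LinearMap.add_apply, LinearMap.sub_apply, two_smul, smul_add]
    abel
  rw [key]
  have h2 : ‖(2 : ℝ)‖ = 2 := by norm_num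
  have hQpp := hQ p p
  have hC1 := hC p p w
  have hC2 := hC p w p
  have hC3 := hC w p p
  have hp := norm_nonneg p
  have hw := norm_nonneg w
  calc ‖(2 : ℝ) • Q p p + (2 : ℝ) • (C p p w + C p w p + C w p p)‖
      ≤ ‖(2 : ℝ) • Q p p‖ + ‖(2 : ℝ) • (C p p w + C p w p + C w p p)‖ := norm_add_le _ _
    _ = 2 * ‖Q p p‖ + 2 * ‖C p p w + C p w p + C w p p‖ := by rw [norm_smul, norm_smul, h2]
    _ ≤ 2 * ‖Q p p‖ + 2 * (‖C p p w‖ + ‖C p w p‖ + ‖C w p p‖) := by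
        gcongr
        exact (norm_add_le _ _).trans (add_le_add (norm_add_le _ _) le_rfl)
    _ ≤ 2 * q₂ * ‖p‖ ^ 2 + 6 * q₃ * ‖w‖ * ‖p‖ ^ 2 := by nlinarith

/-- The record instance: for `b ∈ bends0 = polyBends (1/200) (1/2000)`, `‖b (w + p) − 2 b w + b (w − p)‖ ≤ ‖p‖²/100 + 3‖w‖‖p‖²/1000`. [formal bookkeeping] -/
theorem bends0_secondDiff {b : E3 → E3} (hb : b ∈ bends0) (w p : E3) :
    ‖b (w + p) - (2 : ℝ) • b w + b (w - p)‖ ≤ ‖p‖ ^ 2 / 100 + 3 * ‖w‖ * ‖p‖ ^ 2 / 1000 := by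
  have h := polyBends_secondDiff hb w p
  linarith

/-- Second differences of two triples differ by at most the sum of the two pair deviations. [elementary] -/
theorem secondDiff_sub_le {x₀ x₁ x₂ h₀ h₁ h₂ : E3} {B₁ B₂ : ℝ} (h10 : dist (x₁ - x₀) (h₁ - h₀) ≤ B₁) (h21 : dist (x₂ - x₁) (h₂ - h₁) ≤ B₂) :
    ‖(x₂ - (2 : ℝ) • x₁ + x₀) - (h₂ - (2 : ℝ) • h₁ + h₀)‖ ≤ B₁ + B₂ := by
  rw [dist_eq_norm] at h10 h21
  have e : (x₂ - (2 : ℝ) • x₁ + x₀) - (h₂ - (2 : ℝ) • h₁ + h₀) = (x₂ - x₁ - (h₂ - h₁)) - (x₁ - x₀ - (h₁ - h₀)) := by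
    simp only [two_smul]; abel
  rw [e]
  exact (norm_sub_le _ _).trans (by linarith)

/-- ★ **L3 AGAINST THE TREE PREDICATE `ChartByGB`.** If a cluster `z` is GB-charted by a host `z₀` whose displacements from its centre are a bending
`b ∈ polyBends q₂ q₃` of reference displacements `v` (`z₀ a − z₀ c₀ = b (v a)` — the shape of `IsBentBall`), and three ball sites `a₀ a₁ a₂` are labelled onto
a collinear equally-spaced reference triple `v (e a₀) = w − p`, `v (e a₁) = w`, `v (e a₂) = w + p`, then the cluster's second difference on the triple is at
most the two pair allowances plus the bending's second difference `2 q₂ ‖p‖² + 6 q₃ ‖w‖ ‖p‖²`.  Contrapositive = the census's pair-clause kill: a triple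
with `‖z a₂ − 2 z a₁ + z a₀‖ > B₁₀ + B₂₁ + 2q₂‖p‖² + 6q₃‖w‖‖p‖²` is charted by NO such labelling. [elementary] -/
theorem chartByGB_secondDiff_le {𝓘 : ChartFam} {τ : ℝ} {T : SlackTab} {B : PairTab} {M : ℕ} {z : Fin M → E3} {c : Fin M} {M₀ : ℕ}
    {z₀ : Fin M₀ → E3} {c₀ : Fin M₀} {e : Fin M → Fin M₀} (hGB : ChartByGB 𝓘 τ T B z c z₀ c₀ e)
    {q₂ q₃ : ℝ} {b : E3 → E3} (hb : b ∈ polyBends q₂ q₃) {v : Fin M₀ → E3} (hz₀ : ∀ a, z₀ a - z₀ c₀ = b (v a))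
    {a₀ a₁ a₂ : Fin M} (h₀ : dist (z a₀) (z c) ≤ 63 / 10) (h₁ : dist (z a₁) (z c) ≤ 63 / 10) (h₂ : dist (z a₂) (z c) ≤ 63 / 10)
    {w p : E3} (hv₀ : v (e a₀) = w - p) (hv₁ : v (e a₁) = w) (hv₂ : v (e a₂) = w + p) :
    ‖z a₂ - (2 : ℝ) • z a₁ + z a₀‖ ≤ B M₀ z₀ c₀ (e a₁) (e a₀) + B M₀ z₀ c₀ (e a₂) (e a₁) + (2 * q₂ * ‖p‖ ^ 2 + 6 * q₃ * ‖w‖ * ‖p‖ ^ 2) := by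
  have h10 := hGB.2 a₁ a₀ h₁ h₀
  have h21 := hGB.2 a₂ a₁ h₂ h₁
  have ez : ∀ a a' : Fin M, z₀ (e a) - z₀ (e a') = b (v (e a)) - b (v (e a')) := fun a a' => by
    rw [← hz₀ (e a), ← hz₀ (e a')]; abel
  rw [ez, hv₁, hv₀] at h10
  rw [ez, hv₂, hv₁] at h21
  have hd := secondDiff_sub_le h10 h21
  have hL3 := polyBends_secondDiff hb w p
  have htri : ‖z a₂ - (2 : ℝ) • z a₁ + z a₀‖ ≤ ‖(z a₂ - (2 : ℝ) • z a₁ + z a₀) - (b (w + p) - (2 : ℝ) • b w + b (w - p))‖ +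
      ‖b (w + p) - (2 : ℝ) • b w + b (w - p)‖ := norm_le_norm_sub_add _ _
  linarith

/-- Second differences are invariant under the cluster isometry `R` quantified in `ConeWitness` (`R` linear). [formal bookkeeping] -/
theorem secondDiff_isometry (R : E3 ≃ₗᵢ[ℝ] E3) (x₀ x₁ x₂ : E3) :
    ‖(⇑R ∘ fun k : Fin 3 => ![x₀, x₁, x₂] k) 2 - (2 : ℝ) • (⇑R ∘ fun k : Fin 3 => ![x₀, x₁, x₂] k) 1 + (⇑R ∘ fun k : Fin 3 => ![x₀, x₁, x₂] k) 0‖ =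
      ‖x₂ - (2 : ℝ) • x₁ + x₀‖ := by
  simp only [Function.comp_apply, Matrix.cons_val_zero, Matrix.cons_val_one, Matrix.head_cons, Matrix.cons_val_two, Matrix.tail_cons]
  rw [← map_smul, ← map_sub, ← map_add, LinearIsometryEquiv.norm_map]

/-- The same invariance in the form used with `ConeWitness`'s `⇑R ∘ z`. [formal bookkeeping] -/
theorem secondDiff_comp_isometry (R : E3 ≃ₗᵢ[ℝ] E3) {M : ℕ} (z : Fin M → E3) (a₀ a₁ a₂ : Fin M) :
    ‖(⇑R ∘ z) a₂ - (2 : ℝ) • (⇑R ∘ z) a₁ + (⇑R ∘ z) a₀‖ = ‖z a₂ - (2 : ℝ) • z a₁ + z a₀‖ := by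
  simp only [Function.comp_apply]
  rw [← map_smul, ← map_sub, ← map_add, LinearIsometryEquiv.norm_map]

/-! ## §2. L1 / L2 — the far-class floor `¬GoodAtScale η₀`: typed statements against the tree predicate, the finite pattern cores PROVED, the assembly PROVED -/

section FarClass

open Literature.Geometry.DiscreteGeometry (fccKissingPattern hcpKissingPattern fccInt hcpInt sqNormInt nearestDist)
open Summit.AtomisticToContinuum.Crystallization.Theorems.FrustratedLawDichotomyMotifLemmas (GoodAtScale scale_eq_nearestDist)

/-- The clause list of ONE branch of `…MotifLemmas.GoodAtScale` (text verbatim, pattern `P` generic): positivity, the fit of the assignment `t` in the frame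
`A` at tolerance `η·d`, the two pinning clauses (they force `d = nearestDist y i`, `scale_eq_nearestDist`) and the clean-gap clause. -/
def FitClauses (P : Finset E3) {N : ℕ} (y : Fin N → E3) (i : Fin N) (d η γ : ℝ) (A : E3 →ₗᵢ[ℝ] E3) (t : ↥P → E3) : Prop :=
  0 < d ∧ 0 < γ ∧ (∀ u : ↥P, t u ∈ Set.range y ∧ ‖(t u - y i) - d • A (u : E3)‖ ≤ η * d) ∧
    (∀ s : E3, s ∈ Set.range y → s ≠ y i → d ≤ dist s (y i)) ∧ (∃ s : E3, s ∈ Set.range y ∧ s ≠ y i ∧ dist s (y i) ≤ d) ∧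
    (∀ s : E3, s ∈ Set.range y → s ≠ y i → dist s (y i) < 13 / 10 * d + γ → dist s (y i) ≤ 13 / 10 * d - γ ∧ s ∈ Set.range t)

/-- ★ `GoodAtScale` UNFOLDED into the two clause lists (definitional). [formal bookkeeping] -/
theorem goodAtScale_iff_fitClauses {η₀ D : ℝ} {N : ℕ} {y : Fin N → E3} {i : Fin N} :
    GoodAtScale η₀ D y i ↔ ∃ (d η γ : ℝ) (A : E3 →ₗᵢ[ℝ] E3), d ≤ D ∧
      ((∃ t : ↥fccKissingPattern → E3, η < η₀ ∧ FitClauses fccKissingPattern y i d η γ A t) ∨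
        (∃ t : ↥hcpKissingPattern → E3, η < η₀ ∧ FitClauses hcpKissingPattern y i d η γ A t)) := by
  unfold GoodAtScale FitClauses
  constructor
  · rintro ⟨d, η, γ, A, hd, h⟩
    refine ⟨d, η, γ, A, hd, ?_⟩
    rcases h with ⟨t, h0, hγ, hη, hfit, h1, h2, h3⟩ | ⟨t, h0, hγ, hη, hfit, h1, h2, h3⟩
    · exact Or.inl ⟨t, hη, h0, hγ, hfit, h1, h2, h3⟩
    · exact Or.inr ⟨t, hη, h0, hγ, hfit, h1, h2, h3⟩
  · rintro ⟨d, η, γ, A, hd, h⟩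
    refine ⟨d, η, γ, A, hd, ?_⟩
    rcases h with ⟨t, hη, h0, hγ, hfit, h1, h2, h3⟩ | ⟨t, hη, h0, hγ, hfit, h1, h2, h3⟩
    · exact Or.inl ⟨t, h0, hγ, hη, hfit, h1, h2, h3⟩
    · exact Or.inr ⟨t, h0, hγ, hη, hfit, h1, h2, h3⟩

/-- ★ THE REDUCTION: a tolerance floor `η₀ ≤ η` on every fcc fit and every hcp fit satisfying the clauses gives `¬GoodAtScale η₀ D`. [formal bookkeeping] -/
theorem not_goodAtScale_of_floors {η₀ D : ℝ} {N : ℕ} {y : Fin N → E3} {i : Fin N}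
    (hF : ∀ (d η γ : ℝ) (A : E3 →ₗᵢ[ℝ] E3) (t : ↥fccKissingPattern → E3), d ≤ D → FitClauses fccKissingPattern y i d η γ A t → η₀ ≤ η)
    (hH : ∀ (d η γ : ℝ) (A : E3 →ₗᵢ[ℝ] E3) (t : ↥hcpKissingPattern → E3), d ≤ D → FitClauses hcpKissingPattern y i d η γ A t → η₀ ≤ η) :
    ¬GoodAtScale η₀ D y i := by
  rw [goodAtScale_iff_fitClauses]
  rintro ⟨d, η, γ, A, hd, ⟨t, hη, hc⟩ | ⟨t, hη, hc⟩⟩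
  · exact absurd hη (not_lt.2 (hF d η γ A t hd hc))
  · exact absurd hη (not_lt.2 (hH d η γ A t hd hc))

/-- **SHELL FRAME DATA** (what the census certifies about the cluster, per site): twelve first-shell points `s u` (`u ∈` the fcc pattern), all in the
cluster and distinct from the centre, each bond DIRECTION within `θ` of the frame direction `g u`, all inside the clean-gap radius `13/10·d`, and the first
shell COMPLETE (every cluster point closer than `13/10·d` to the centre is one of them).  For W94c: `θ = 2 sin(1.89°/2) ≈ 0.033`, `r₁₂/d = 1.1037 < 13/10`,
`r₁₃/d = 1.4212 > 13/10`. -/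
def ShellFrame {N : ℕ} (y : Fin N → E3) (i : Fin N) (d θ : ℝ) (g : E3 →ₗᵢ[ℝ] E3) (s : ↥fccKissingPattern → E3) : Prop :=
  (∀ u, s u ∈ Set.range y) ∧ (∀ u, s u ≠ y i) ∧ (∀ u, ‖(‖s u - y i‖)⁻¹ • (s u - y i) - g (u : E3)‖ ≤ θ) ∧ (∀ u, dist (s u) (y i) < 13 / 10 * d) ∧
    ∀ x : E3, x ∈ Set.range y → x ≠ y i → dist x (y i) < 13 / 10 * d → x ∈ Set.range s

/-- ★ **L1 — FORCED ASSIGNMENT (typed; claimed for `η₀ + θ < 1/8`).** Below tolerance `η₀`, ANY fcc fit `(A, t)` of a site with shell frame data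
`(θ, g, s)` is, after reframing, a fit of the FORCED assignment `s` at the same tolerance: `∃ A', ∀ u, ‖(s u − y i) − d • A' u‖ ≤ η·d`.  Intended proof
(finite geometry of the cuboctahedron; core = `fccInt_sub_sqNorm` below): (1) `‖t u − y i‖ ∈ [d(1−η), d(1+η)] ⊂ (0, 13/10·d)`, so by completeness `t u ∈ range s`,
and `t` is injective (pattern distances `≥ 1 > 2η`), hence `t = s ∘ π` for a permutation `π` of the pattern; (2) radial projection onto the unit ball is
non-expansive and `‖(t u − y i)/d‖ ≥ 1`, so the bond DIRECTION satisfies `‖dir(t u − y i) − A u‖ ≤ η`, whence `‖A u − g (π u)‖ ≤ η + θ` for all `u`;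
(3) `|⟪π u, π u'⟫ − ⟪u, u'⟫| = |⟪g π u, g π u'⟫ − ⟪A u, A u'⟫| ≤ 2(η + θ) < 1/4`, but the pattern's Gram entries lie in `{0, ±1/2, ±1}` (squared distances in
`{0, 1, 2, 3, 4}`), so `π` preserves the Gram matrix and (the pattern spans `E3`) is the restriction of a linear isometry `S`; (4) `A' := A ∘ S⁻¹`.
Margin at W94c: `2(0.05 + 0.033) = 0.17 < 0.25`. -/
def ForcedAssignmentFcc (η₀ θ : ℝ) : Prop :=
  ∀ (N : ℕ) (y : Fin N → E3) (i : Fin N) (g : E3 →ₗᵢ[ℝ] E3) (s : ↥fccKissingPattern → E3), Function.Injective y →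
    ShellFrame y i (nearestDist y i) θ g s →
    ∀ (η γ : ℝ) (A : E3 →ₗᵢ[ℝ] E3) (t : ↥fccKissingPattern → E3), FitClauses fccKissingPattern y i (nearestDist y i) η γ A t → η < η₀ →
      ∃ A' : E3 →ₗᵢ[ℝ] E3, ∀ u, ‖(s u - y i) - nearestDist y i • A' (u : E3)‖ ≤ η * nearestDist y i

/-- ★ **L2 — HCP EXCLUDED NEAR AN FCC FRAME (typed; claimed for `2(η₀ + θ) < 1/√3`).** A site whose first shell is directionally `θ`-close to an fcc
frame admits NO hcp fit below `η₀`.  Intended proof (cores = `fccInt_neg_mem`, `hcpInt_antipodes`, `hcpInt_add_sqNorm` below): the fcc frame has SIX antipodal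
pairs, so the shell has six disjoint direction pairs with `‖v̂ + v̂'‖ ≤ 2θ`; an hcp fit `t` with `η < η₀` is a bijection onto the shell (as in L1 (1)) with
direction errors `≤ η` (L1 (2)), so the pre-images `a ≠ a'` of such a pair satisfy `‖a + a'‖ = ‖A a + A a'‖ ≤ 2θ + 2η < 1/√3`, forcing `a' = −a` — six
disjoint antipodal pairs in the hcp pattern, which has exactly THREE.  Margin at W94c: `2(0.05 + 0.033) = 0.17 < 0.577`. -/
def HcpExcludedNearFcc (η₀ θ : ℝ) : Prop :=
  ∀ (N : ℕ) (y : Fin N → E3) (i : Fin N) (g : E3 →ₗᵢ[ℝ] E3) (s : ↥fccKissingPattern → E3), Function.Injective y →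
    ShellFrame y i (nearestDist y i) θ g s →
    ∀ (η γ : ℝ) (A : E3 →ₗᵢ[ℝ] E3) (t : ↥hcpKissingPattern → E3), FitClauses hcpKissingPattern y i (nearestDist y i) η γ A t → η₀ ≤ η

/-- ★★ **THE FAR-CLASS ASSEMBLY (PROVED modulo the typed L1, L2):** shell frame data + the Kabsch floor of the FORCED assignment over ALL linear isometries
(`hK`: `min_{A'} max_u ‖(s u − y i) − d A' u‖ ≥ η₀ d`, both chiralities — the census's certified `0.05231·d > d/20`) ⟹ `¬GoodAtScale η₀ D y i`.
With `η₀ = 1/20` at every site of the `9/5`-ball this is `¬TightNearCap (9/5) (3/2)`, the far-class conjunct of `Admissible` in `ConeWitness`. -/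
theorem not_goodAtScale_of_shellFrame {η₀ θ D : ℝ} (hL1 : ForcedAssignmentFcc η₀ θ) (hL2 : HcpExcludedNearFcc η₀ θ)
    {N : ℕ} {y : Fin N → E3} {i : Fin N} (hy : Function.Injective y) {g : E3 →ₗᵢ[ℝ] E3} {s : ↥fccKissingPattern → E3}
    (hfr : ShellFrame y i (nearestDist y i) θ g s)
    (hK : ∀ A' : E3 →ₗᵢ[ℝ] E3, ∃ u, η₀ * nearestDist y i ≤ ‖(s u - y i) - nearestDist y i • A' (u : E3)‖) :
    ¬GoodAtScale η₀ D y i := by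
  refine not_goodAtScale_of_floors (fun d η γ A t _ hc => ?_) (fun d η γ A t _ hc => ?_)
  · rcases le_or_gt η₀ η with hge | hlt
    · exact hge
    · exfalso
      have hd : d = nearestDist y i := scale_eq_nearestDist hy hc.2.2.2.1 hc.2.2.2.2.1
      subst hd
      obtain ⟨A', hA'⟩ := hL1 N y i g s hy hfr η γ A t hc hlt
      obtain ⟨u, hu⟩ := hK A'
      have hpos : 0 < nearestDist y i := hc.1
      have : η₀ * nearestDist y i ≤ η * nearestDist y i := hu.trans (hA' u)
      exact absurd (le_of_mul_le_mul_right this hpos) (not_le.2 hlt)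
  · have hd : d = nearestDist y i := scale_eq_nearestDist hy hc.2.2.2.1 hc.2.2.2.2.1
    subst hd
    exact hL2 N y i g s hy hfr η γ A t hc

/-! ### The finite pattern cores of L1 and L2 (integer models, `decide`) -/

-- (landing lane, hand-2 g41, gate `dedup.landed`: the two L1 cores are ALREADY tree theorems and were removed here —
--  `fccInt_sub_sqNorm` ≡ `Summit.AtomisticToContinuum.Crystallization.Theorems.FrustratedLawDichotomyKissingPatternCombinatorics.fccInt_sqNormInt_sub_mem`
--  (…/Theorems/FrustratedLawDichotomyKissingPatternCombinatorics.lean) and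
--  `fccInt_neg_mem` ≡ `Summit.AtomisticToContinuum.Crystallization.Theorems.DefectFreeCrystallizes.Negative.TypeGap.fccInt_neg_mem`
--  (…/Theorems/DefectFreeCrystallizes/Negative/TypeGap.lean); cite those by name where the docstrings above say `fccInt_sub_sqNorm` / `fccInt_neg_mem`.)

/-- L2 core (a): exactly SIX anticuboctahedron vectors (the hexagonal layer) have their antipode in the pattern — three antipodal pairs. [folklore: decide] -/
theorem hcpInt_antipodes : (hcpInt.filter fun v => -v ∈ hcpInt).card = 6 := by decide

/-- L2 core (b): two anticuboctahedron vectors are antipodal or their sum has squared norm `≥ 6` (scale `18`): `‖u + u'‖ ≥ 1/√3 ≈ 0.577` for every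
non-antipodal pair of the hcp kissing pattern. [folklore: decide] -/
theorem hcpInt_add_sqNorm : ∀ v ∈ hcpInt, ∀ w ∈ hcpInt, v + w = 0 ∨ 6 ≤ sqNormInt (v + w) := by decide

end FarClass

end Summit.AtomisticToContinuum.Crystallization.Theorems.FrustratedLawDichotomyStrainedPatchConeWitnessKit
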